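import Summits.QuantumFields.YangMills.Theorems.BalabanUVNodesN15KingModelPotential

/-!
# N15 (NE2⁺), King-model rung, part 23a: block means versus lattice gradients on King's fine torus (lattice calculus)

Cell `pub-ymgap-dag-n15-d` (R134 acceleration DAG, node N15 = NE2, strategy s3 KING-MODEL RUNG), part 23a.  Generic lattice calculus on King's
two-level torus (`Tor (fine N U)` over the unit torus `Tor U`, blocks `B(y) = {site N U y j}`), used by part 23b to show that the `p = 1`
(GRADIENT) sup entry of the dressed minimiser also fails `NE2PlusSite` on the size-only sort:

* `site_add_unitVec` — `site(y + e_μ, j) = site(y, j) + N·ε_μ` (a unit step of the block is `N` fine steps);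
* `sub_eq_sum_steps`, ★ `blockMean_step_eq` — the difference of two ADJACENT block means is an average of unit-lattice gradients
  `∂^η_μF(w) = N(F(w + ε_μ) − F(w))` over `N^{d+2}` fine points: `mean(y+e_μ) − mean(y) = N^{−(d+1)}Σ_j N⁻¹Σ_{t<N} ∂^η_μF(site(y,j) + tε_μ)`;
* ★ `exists_grad_ge_of_blockMean_step` — hence `|mean(y+e_μ) − mean(y)| ≥ g` forces `|∂^η_μF(w)| ≥ g` at some fine point `w`;
* `exists_step_ge`, `exists_le_of_sum_abs_le` — one-dimensional pigeonholes (a drop `f 0 − f n ≥ G` has a step `≥ G∕n`; a line whose absolute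
  sum is `< n·g` has a value `≤ g`); `line_injective`, `sum_line_le_sum` — an axis line of the unit torus is injective, so a nonnegative block
  function sums to at most its total along it.

HONEST SCOPE.  Elementary finite sums on `Π ℤ∕(N·U_μ)`; no analysis, no physics; count-neutral (`--supports`), not a discharge of N15; THEOREMS
ONLY (0 `def`, 0 `sorry`).

References: C. King, Commun. Math. Phys. 102 (1986) 649–677, (2.10)–(2.11) p.653 (the blocks `B^k(y)` and the block averaging operators `Q_k`) (bib key `King1986`).
-/

noncomputable section
open scoped BigOperators Matrix
open Finset

namespace Summit.QuantumFields.YangMills.BalabanUVNodes.N15.KingModel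

open Literature.MathematicalPhysics.QuantumFieldTheory.Balaban1983to89 hiding blockOf
open Literature.MathematicalPhysics.QuantumFieldTheory.Balaban1983to89.B5Prop11Plancherel (Tor fine unitVec)
open Literature.MathematicalPhysics.QuantumFieldTheory.King1986.Torus

variable {d : ℕ}

section Lattice

variable (N : ℕ) [NeZero N] (U : Fin (d + 1) → ℕ) [∀ μ, NeZero (U μ)]

omit [NeZero N] in
/-- In `ZMod (N·U)`: `N·((v+1) mod U) + j = (N·v + j) + N`. [folklore] -/
theorem cast_mul_succ_mod_add (Uν : ℕ) (v j : ℕ) :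
    ((N * ((v + 1) % Uν) + j : ℕ) : ZMod (N * Uν)) = ((N * v + j : ℕ) : ZMod (N * Uν)) + (N : ZMod (N * Uν)) := by
  have hdm := Nat.div_add_mod (v + 1) Uν
  have e1 : N * (v + 1) + j = (N * Uν) * ((v + 1) / Uν) + (N * ((v + 1) % Uν) + j) := by
    calc N * (v + 1) + j = N * (Uν * ((v + 1) / Uν) + (v + 1) % Uν) + j := by rw [hdm]
      _ = _ := by ring
  have e2 : ((N * (v + 1) + j : ℕ) : ZMod (N * Uν)) = ((N * ((v + 1) % Uν) + j : ℕ) : ZMod (N * Uν)) := by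
    rw [e1, Nat.cast_add (N * Uν * ((v + 1) / Uν)), Nat.cast_mul (N * Uν), ZMod.natCast_self, zero_mul, zero_add]
  rw [← e2]
  push_cast
  ring

omit [NeZero N] in
/-- Moving the block one unit step moves its sites by `N` fine steps: `site(y + e_μ, j) = site(y, j) + N·e_μ`. [cite: King1986, (2.10) p.653 (the blocks `B^k(y)`)] -/
theorem site_add_unitVec (y : Tor U) (j : Fin (d + 1) → Fin N) (μ : Fin (d + 1)) :
    site N U (y + unitVec U μ) j = site N U y j + N • unitVec (fine N U) μ := by
  funext ν
  by_cases h : ν = μ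
  · subst h
    have hval : ((y ν + 1 : ZMod (U ν))).val = ((y ν).val + 1) % U ν := by
      rw [ZMod.val_add, ZMod.val_one_eq_one_mod, Nat.add_mod_mod]
    simp only [site, unitVec, Pi.add_apply, Pi.smul_apply, Pi.single_eq_same]
    rw [hval, nsmul_eq_mul, mul_one]
    exact cast_mul_succ_mod_add N (U ν) (y ν).val (j ν)
  · simp only [site, unitVec, Pi.add_apply, Pi.smul_apply, Pi.single_eq_of_ne h, add_zero, smul_zero]

omit [NeZero N] [∀ μ, NeZero (U μ)] in
/-- A fine step telescoped over a block side: `F(z + N·ε) − F(z) = Σ_{t<N} (F(z + (t+1)·ε) − F(z + t·ε))`. [folklore] -/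
theorem sub_eq_sum_steps (F : Tor (fine N U) → ℝ) (z ε : Tor (fine N U)) :
    F (z + N • ε) - F z = ∑ t ∈ Finset.range N, (F (z + t • ε + ε) - F (z + t • ε)) := by
  have h := Finset.sum_range_sub (fun t => F (z + t • ε)) N
  simp only [zero_smul, add_zero] at h
  rw [← h]
  refine Finset.sum_congr rfl fun t _ => ?_
  rw [succ_nsmul, add_assoc]

/-- **THE DIFFERENCE OF TWO ADJACENT BLOCK MEANS IS AN AVERAGE OF LATTICE GRADIENTS**: with the unit-lattice gradient `∂^η_μF(w) = N(F(w + ε_μ) − F(w))`,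
`N^{−D}Σ_j F(site(y+e_μ, j)) − N^{−D}Σ_j F(site(y, j)) = N^{−D}Σ_j N⁻¹Σ_{t<N} ∂^η_μF(site(y,j) + tε_μ)`. [folklore] -/
theorem blockMean_step_eq (F : Tor (fine N U) → ℝ) (y : Tor U) (μ : Fin (d + 1)) :
    (((N : ℕ) : ℝ) ^ (d + 1))⁻¹ * ∑ j : Fin (d + 1) → Fin N, F (site N U (y + unitVec U μ) j)
        - (((N : ℕ) : ℝ) ^ (d + 1))⁻¹ * ∑ j : Fin (d + 1) → Fin N, F (site N U y j)
      = (((N : ℕ) : ℝ) ^ (d + 1))⁻¹ * ∑ j : Fin (d + 1) → Fin N, ((N : ℝ)⁻¹ * ∑ t ∈ Finset.range N,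
          (N : ℝ) * (F (site N U y j + t • unitVec (fine N U) μ + unitVec (fine N U) μ) - F (site N U y j + t • unitVec (fine N U) μ))) := by
  have hN : (N : ℝ) ≠ 0 := Nat.cast_ne_zero.mpr (NeZero.ne N)
  rw [← mul_sub, ← Finset.sum_sub_distrib]
  refine congrArg _ (Finset.sum_congr rfl fun j _ => ?_)
  rw [site_add_unitVec, sub_eq_sum_steps, Finset.mul_sum]
  refine Finset.sum_congr rfl fun t _ => ?_
  rw [← mul_assoc, inv_mul_cancel₀ hN, one_mul]

/-- **A LARGE BLOCK-MEAN STEP FORCES A LARGE GRADIENT SOMEWHERE**: if `|mean(y + e_μ) − mean(y)| ≥ g`, some fine point `w` has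
`|N(F(w + ε_μ) − F(w))| ≥ g`. [folklore] -/
theorem exists_grad_ge_of_blockMean_step (F : Tor (fine N U) → ℝ) (y : Tor U) (μ : Fin (d + 1)) {g : ℝ}
    (hg : g ≤ |(((N : ℕ) : ℝ) ^ (d + 1))⁻¹ * ∑ j : Fin (d + 1) → Fin N, F (site N U (y + unitVec U μ) j)
        - (((N : ℕ) : ℝ) ^ (d + 1))⁻¹ * ∑ j : Fin (d + 1) → Fin N, F (site N U y j)|) :
    ∃ w : Tor (fine N U), g ≤ |(N : ℝ) * (F (w + unitVec (fine N U) μ) - F w)| := by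
  by_contra hcon
  simp only [not_exists, not_le] at hcon
  have hNpos : (0 : ℝ) < N := Nat.cast_pos.mpr (Nat.pos_of_ne_zero (NeZero.ne N))
  have hD : (0 : ℝ) < ((N : ℕ) : ℝ) ^ (d + 1) := pow_pos hNpos _
  set ε := unitVec (fine N U) μ with hε
  -- every inner average is `< g` in absolute value
  have hinner : ∀ j : Fin (d + 1) → Fin N, |(N : ℝ)⁻¹ * ∑ t ∈ Finset.range N,
      (N : ℝ) * (F (site N U y j + t • ε + ε) - F (site N U y j + t • ε))| < g := by
    intro j
    rw [abs_mul, abs_of_pos (inv_pos.mpr hNpos), inv_mul_lt_iff₀ hNpos]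
    calc |∑ t ∈ Finset.range N, (N : ℝ) * (F (site N U y j + t • ε + ε) - F (site N U y j + t • ε))|
        ≤ ∑ t ∈ Finset.range N, |(N : ℝ) * (F (site N U y j + t • ε + ε) - F (site N U y j + t • ε))| := abs_sum_le_sum_abs _ _
      _ < ∑ _t ∈ Finset.range N, g := Finset.sum_lt_sum_of_nonempty ⟨0, Finset.mem_range.mpr (Nat.pos_of_ne_zero (NeZero.ne N))⟩
          (fun t _ => hcon _)
      _ = (N : ℝ) * g := by rw [Finset.sum_const, Finset.card_range, nsmul_eq_mul]
  have houter : |(((N : ℕ) : ℝ) ^ (d + 1))⁻¹ * ∑ j : Fin (d + 1) → Fin N, ((N : ℝ)⁻¹ * ∑ t ∈ Finset.range N,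
      (N : ℝ) * (F (site N U y j + t • ε + ε) - F (site N U y j + t • ε)))| < g := by
    rw [abs_mul, abs_of_pos (inv_pos.mpr hD), inv_mul_lt_iff₀ hD]
    calc |∑ j : Fin (d + 1) → Fin N, ((N : ℝ)⁻¹ * ∑ t ∈ Finset.range N,
            (N : ℝ) * (F (site N U y j + t • ε + ε) - F (site N U y j + t • ε)))|
        ≤ ∑ j : Fin (d + 1) → Fin N, |(N : ℝ)⁻¹ * ∑ t ∈ Finset.range N,
            (N : ℝ) * (F (site N U y j + t • ε + ε) - F (site N U y j + t • ε))| := abs_sum_le_sum_abs _ _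
      _ < ∑ _j : Fin (d + 1) → Fin N, g := Finset.sum_lt_sum_of_nonempty Finset.univ_nonempty (fun j _ => hinner j)
      _ = ((N : ℕ) : ℝ) ^ (d + 1) * g := by rw [Finset.sum_const, Finset.card_univ, nsmul_eq_mul, card_offsets N]
  rw [blockMean_step_eq] at hg
  exact absurd (lt_of_le_of_lt hg houter) (lt_irrefl _)

/-- ONE-DIMENSIONAL PIGEONHOLE: if `f 0 − f n ≥ G` (`n ≥ 1`) some step has `f s − f (s+1) ≥ G∕n`. [folklore] -/
theorem exists_step_ge (f : ℕ → ℝ) {n : ℕ} (hn : 1 ≤ n) {G : ℝ} (h : G ≤ f 0 - f n) :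
    ∃ s, s < n ∧ G / n ≤ f s - f (s + 1) := by
  by_contra hcon
  simp only [not_exists, not_and, not_le] at hcon
  have hnpos : (0 : ℝ) < n := by exact_mod_cast hn
  have hsum : ∑ s ∈ Finset.range n, (f s - f (s + 1)) = f 0 - f n := by
    have := Finset.sum_range_sub (fun s => f s) n
    linarith [Finset.sum_range_sub (fun s => f s) n, show ∑ s ∈ Finset.range n, (f s - f (s + 1))
      = -∑ s ∈ Finset.range n, (f (s + 1) - f s) from by rw [← Finset.sum_neg_distrib]; exact Finset.sum_congr rfl fun s _ => by ring]
  have hlt : ∑ s ∈ Finset.range n, (f s - f (s + 1)) < ∑ _s ∈ Finset.range n, G / n :=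
    Finset.sum_lt_sum_of_nonempty ⟨0, Finset.mem_range.mpr hn⟩ fun s hs => hcon s (Finset.mem_range.mp hs)
  rw [hsum, Finset.sum_const, Finset.card_range, nsmul_eq_mul, mul_div_cancel₀ G hnpos.ne'] at hlt
  linarith

/-- LINE PIGEONHOLE: if `Σ_{s<n}|f s| ≤ T` and `T < n·g` then `f s ≤ g` for some `s < n`. [folklore] -/
theorem exists_le_of_sum_abs_le (f : ℕ → ℝ) {n : ℕ} (hn : 1 ≤ n) {T g : ℝ} (hT : ∑ s ∈ Finset.range n, |f s| ≤ T)
    (hg : T < n * g) : ∃ s, s < n ∧ f s ≤ g := by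
  by_contra hcon
  simp only [not_exists, not_and, not_le] at hcon
  have hlt : ∑ _s ∈ Finset.range n, g < ∑ s ∈ Finset.range n, |f s| :=
    Finset.sum_lt_sum_of_nonempty ⟨0, Finset.mem_range.mpr hn⟩ fun s hs => (hcon s (Finset.mem_range.mp hs)).trans_le (le_abs_self _)
  rw [Finset.sum_const, Finset.card_range, nsmul_eq_mul] at hlt
  linarith

omit [∀ μ, NeZero (U μ)] in
/-- Distinct step counts `s, s′ < U_μ` along axis `μ` give distinct unit sites. [folklore] -/
theorem line_injective (b : Tor U) (μ : Fin (d + 1)) {s s' : ℕ} (hs : s < U μ) (hs' : s' < U μ)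
    (h : b + s • unitVec U μ = b + s' • unitVec U μ) : s = s' := by
  have h1 := congrFun (add_left_cancel h) μ
  simp only [unitVec, Pi.smul_apply, Pi.single_eq_same, nsmul_eq_mul, mul_one] at h1
  have h2 := congrArg ZMod.val h1
  rwa [ZMod.val_natCast, ZMod.val_natCast, Nat.mod_eq_of_lt hs, Nat.mod_eq_of_lt hs'] at h2

/-- The sum of a nonnegative block function along an axis line is at most its sum over the whole unit torus. [folklore] -/
theorem sum_line_le_sum (G : Tor U → ℝ) (hG : ∀ y, 0 ≤ G y) (b : Tor U) (μ : Fin (d + 1)) :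
    ∑ s ∈ Finset.range (U μ), G (b + s • unitVec U μ) ≤ ∑ y, G y := by
  rw [← Finset.sum_image (f := G) (s := Finset.range (U μ)) (g := fun s => b + s • unitVec U μ)
    (fun s hs s' hs' h => line_injective U b μ (Finset.mem_range.mp hs) (Finset.mem_range.mp hs') h)]
  exact Finset.sum_le_sum_of_subset_of_nonneg (Finset.subset_univ _) fun y _ _ => hG y

end Lattice

end Summit.QuantumFields.YangMills.BalabanUVNodes.N15.KingModel

end
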